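import Literature.Computability.AlgebraicComplexity.TwoRowRectangleKronecker
import Literature.RepresentationTheory.FiniteGroups.SymmetricGroupSquareEvaluation
import Literature.Barriers.ValiantsHypothesis.GCTMatrixPoweringProp17OnlyIf
import HarnessLib

/-!
# The sign character and the standard character of `𝔖_n`: `χ^{(1ⁿ)} = sgn`,
# `χ^{(n−1,1)} = #fix − 1`, `χ^{(2,1^{n−2})} = sgn · (#fix − 1)` (PROVED)

Cell `val-lit` (D-0074), row `LMR13-A` support (val-lit-t11 g2): the two character values needed for
the immanants `IM_{1ⁿ} = det_n` and `IM_{21^{n−2}}` of Landsberg–Manivel–Ressayre 2013, Prop. 3.4.2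
("`P_n = {1ⁿ, 21^{n−2}}`", typed `LMR2013_prop_3_4_2` in
`Literature/Computability/AlgebraicComplexity/LMR13DualVarieties.lean`). Theorem-only (no definitions, no
facts), assembled from results already in the tree:

* `spechtCharacter_indiscrete_transpose` — **`χ^{(n)ᵀ}(σ) = χ^{(1ⁿ)}(σ) = sgn σ`**: from
  `χ^λ = sgn·χ^{λᵀ}` (`MNEval.spechtCharacter_eq_sign_mul_transpose`, James LNM 682, 6.6) and
  `χ^{(n)} ≡ 1` (`spechtCharacter_indiscrete`).
* `spechtCharacter_twoRow_one` — **`χ^{(n−1,1)}(σ) = #{p : σ p = p} − 1`** (`n ≥ 2`; the standard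
  representation): Young's rule in the two-letter Frobenius form `spechtCharacter_twoRow_eq_card_sub_card`
  (`χ^{(D−k,k)}` = difference of counts of `σ`-invariant indicator words) at `k = 1`, where the
  invariant words with exactly one `1` are the fixed points of `σ` and the zero word is the only word
  with no `1`.
* `spechtCharacter_twoRow_one_transpose` — **`χ^{(n−1,1)ᵀ}(σ) = χ^{(2,1^{n−2})}(σ) = sgn σ · (#fix σ − 1)`**.

Honest framing: textbook character values (Fulton–Harris §4.1, James 6.6); bookkeeping for a literature
row; **VP ≠ VNP is NOT proved and nothing here is progress on it.**

## References

* [FultonHarrisGTM129] W. Fulton, J. Harris, *Representation Theory*, GTM 129, Springer 1991, §4.1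
  (the trivial, sign and standard representations of `𝔖_d`; Exercise 4.6 / (4.33) Frobenius formula).
* [JamesLNM682] G. D. James, *The Representation Theory of the Symmetric Groups*, LNM 682, Springer
  1978, 6.6–6.7 (`S^{λ'} ≅ S^λ ⊗ sgn`).
* [LandsbergManivelRessayre2013] J. M. Landsberg, L. Manivel, N. Ressayre, Comment. Math. Helv. 88
  (2013), §3.4 (immanants; "`[1ⁿ]` is the sign representation and `IM_{(1ⁿ)}` is the determinant").
-/

open Literature.NumberTheory.DiophantineGeometry Literature.RepresentationTheory.FiniteGroups
  Literature.Barriers.ValiantsHypothesis Literature.Computability.AlgebraicComplexity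

namespace Literature.RepresentationTheory.FiniteGroups

variable {n : ℕ}

/-- **`χ^{(1ⁿ)} = sgn`**: the Specht character of the column `(n)ᵀ = (1ⁿ)` is the sign character
(`χ^λ = sgn · χ^{λᵀ}` with `χ^{(n)} ≡ 1`). [cite: JamesLNM682, 6.6] -/
theorem spechtCharacter_indiscrete_transpose (σ : Equiv.Perm (Fin n)) :
    spechtCharacter ℂ (Nat.Partition.indiscrete n).transpose σ = ((Equiv.Perm.sign σ : ℤ) : ℂ) := by
  rw [MNEval.spechtCharacter_eq_sign_mul_transpose, Nat.Partition.transpose_transpose,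
    spechtCharacter_indiscrete, mul_one]

/-- **`χ^{(n−1,1)}(σ) = #fix(σ) − 1`** (`n ≥ 2`; the character of the standard representation):
Young's rule `χ^{(n−1,1)} = 1↑_{𝔖_{n−1}×𝔖_1} − 1↑_{𝔖_n}` in the word-count form
`spechtCharacter_twoRow_eq_card_sub_card` — the `σ`-invariant indicator words with exactly one `1` are
the fixed points of `σ`, and the zero word is the unique word without a `1`.
[cite: FultonHarrisGTM129, §4.1 (standard representation, χ = #fixed points − 1)] -/
theorem spechtCharacter_twoRow_one (hn : 2 ≤ n) (σ : Equiv.Perm (Fin n)) :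
    spechtCharacter ℂ (Nat.Partition.twoRow n 1 (by omega)) σ =
      ((Finset.univ.filter fun p : Fin n => σ p = p).card : ℂ) - 1 := by
  classical
  rw [spechtCharacter_twoRow_eq_card_sub_card (show 2 * 1 ≤ n by omega) σ]
  congr 1
  · norm_cast
    -- invariant indicator words with exactly one `1` ↔ fixed points of `σ`
    refine Finset.card_nbij' (fun w => if h : ∃ p, w p = 1 then h.choose else ⟨0, by omega⟩)
      (fun p q => if q = p then 1 else 0) ?_ ?_ ?_ ?_
    · intro w hw
      rw [Finset.mem_coe, Finset.mem_filter] at hw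
      obtain ⟨-, hinv, h0, h1⟩ := hw
      have hex : ∃ p, w p = 1 := by
        by_contra hne
        rw [Finset.card_eq_one] at h1
        obtain ⟨a, ha⟩ := h1
        have : a ∈ Finset.univ.filter fun p => w p = 1 := by rw [ha]; exact Finset.mem_singleton_self a
        exact hne ⟨a, (Finset.mem_filter.mp this).2⟩
      beta_reduce
      rw [dif_pos hex, Finset.mem_coe, Finset.mem_filter]
      refine ⟨Finset.mem_univ _, ?_⟩
      -- σ fixes the unique `1`-position
      set p := hex.choose with hp
      have hwp : w p = 1 := hex.choose_spec
      have hσp : w (σ p) = 1 := by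
        have := congr_fun hinv p
        simpa using this.trans hwp  -- (w ∘ σ) p = w p
      rw [Finset.card_eq_one] at h1
      obtain ⟨a, ha⟩ := h1
      have hmem : ∀ q, w q = 1 → q = a := fun q hq => by
        have : q ∈ Finset.univ.filter fun p => w p = 1 := Finset.mem_filter.mpr ⟨Finset.mem_univ _, hq⟩
        rw [ha] at this; exact Finset.mem_singleton.mp this
      rw [hmem _ hσp, hmem _ hwp]
    · intro p hp
      rw [Finset.mem_coe, Finset.mem_filter] at hp
      obtain ⟨-, hp⟩ := hp
      rw [Finset.mem_coe, Finset.mem_filter]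
      refine ⟨Finset.mem_univ _, ?_, ?_, ?_⟩
      · funext q
        simp only [Function.comp_apply]
        by_cases hq : q = p
        · subst hq; rw [hp]
        · have : σ q ≠ p := fun h => hq (σ.injective (h.trans hp.symm))
          rw [if_neg this, if_neg hq]
      · -- zeros: all but `p`
        have : (Finset.univ.filter fun q : Fin n => (if q = p then (1 : Fin 2) else 0) = 0) =
            Finset.univ.erase p := by
          ext q
          simp only [Finset.mem_filter, Finset.mem_univ, true_and, Finset.mem_erase, and_true]
          by_cases hq : q = p <;> simp [hq]
        rw [this, Finset.card_erase_of_mem (Finset.mem_univ _), Finset.card_univ, Fintype.card_fin]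
      · have : (Finset.univ.filter fun q : Fin n => (if q = p then (1 : Fin 2) else 0) = 1) = {p} := by
          ext q
          simp only [Finset.mem_filter, Finset.mem_univ, true_and, Finset.mem_singleton]
          by_cases hq : q = p <;> simp [hq]
        rw [this, Finset.card_singleton]
    · -- left inverse: word ↦ position ↦ word
      intro w hw
      rw [Finset.mem_coe, Finset.mem_filter] at hw
      obtain ⟨-, -, h0, h1⟩ := hw
      rw [Finset.card_eq_one] at h1
      obtain ⟨a, ha⟩ := h1
      have hmem : ∀ q, w q = 1 ↔ q = a := fun q =>
        ⟨fun hq => by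
          have : q ∈ Finset.univ.filter fun p => w p = 1 := Finset.mem_filter.mpr ⟨Finset.mem_univ _, hq⟩
          rw [ha] at this; exact Finset.mem_singleton.mp this,
         fun hq => by
          have : a ∈ Finset.univ.filter fun p => w p = 1 := by rw [ha]; exact Finset.mem_singleton_self a
          rw [hq]; exact (Finset.mem_filter.mp this).2⟩
      have hex : ∃ p, w p = 1 := ⟨a, (hmem a).mpr rfl⟩
      simp only [dif_pos hex]
      have hc : hex.choose = a := (hmem _).mp hex.choose_spec
      funext q
      rw [hc]
      by_cases hq : q = a
      · rw [if_pos hq, ((hmem q).mpr hq)]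
      · rw [if_neg hq]
        have : w q ≠ 1 := fun h => hq ((hmem q).mp h)
        -- `Fin 2`: not 1 ⇒ 0
        rcases Fin.exists_fin_two.mp ⟨w q, rfl⟩ with h | h
        · exact h.symm
        · exact absurd h this
    · intro p hp
      have hex : ∃ q : Fin n, (if q = p then (1 : Fin 2) else 0) = 1 := ⟨p, by simp⟩
      simp only [dif_pos hex]
      have := hex.choose_spec
      by_contra hne
      rw [if_neg hne] at this
      exact absurd this (by decide)
  · norm_cast
    rw [Finset.card_eq_one]
    refine ⟨fun _ => 0, ?_⟩
    ext w
    simp only [Finset.mem_filter, Finset.mem_univ, true_and, Finset.mem_singleton]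
    constructor
    · rintro ⟨-, h0, -⟩
      -- all `n` positions are zeros
      funext q
      have hq : q ∈ Finset.univ.filter fun p => w p = 0 := by
        have hcard : (Finset.univ.filter fun p => w p = 0) = Finset.univ :=
          Finset.eq_univ_of_card _ (by rw [h0, Fintype.card_fin]; omega)
        rw [hcard]; exact Finset.mem_univ q
      exact (Finset.mem_filter.mp hq).2
    · rintro rfl
      refine ⟨rfl, ?_, ?_⟩
      · simp; omega
      · simp

/-- **`χ^{(2,1^{n−2})}(σ) = sgn σ · (#fix(σ) − 1)`** for the hook `(2,1^{n−2}) = (n−1,1)ᵀ` (`n ≥ 2`):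
`χ^{λᵀ} = sgn · χ^λ` applied to `spechtCharacter_twoRow_one`. [cite: JamesLNM682, 6.6] -/
theorem spechtCharacter_twoRow_one_transpose (hn : 2 ≤ n) (σ : Equiv.Perm (Fin n)) :
    spechtCharacter ℂ (Nat.Partition.twoRow n 1 (by omega)).transpose σ =
      ((Equiv.Perm.sign σ : ℤ) : ℂ) * (((Finset.univ.filter fun p : Fin n => σ p = p).card : ℂ) - 1) := by
  rw [MNEval.spechtCharacter_eq_sign_mul_transpose, Nat.Partition.transpose_transpose,
    spechtCharacter_twoRow_one hn]

end Literature.RepresentationTheory.FiniteGroups
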